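import Literature.NumberTheory.GelbartRogawski1991.DoubledUnitaryGlobalSplittingData
import HarnessLib

/-!
# Block algebra of the Siegel parabolic `P_Δ(𝔸)` of the doubled unitary group

[GelbartRogawski1991, §3.1 Prop. 3.1.1] by doubling [Kudla1994, §2], [HarrisKudlaSweet1996, §1]: elementary matrix
algebra for the stabiliser `P_Δ` of the diagonal `Δ ⊂ 𝕍 ⊕ 𝕍` in the adelic group `H(𝔸) = U(𝕍 ⊕ −𝕍)(𝔸)` of
`DoubledUnitaryGlobalSplittingData`.  In the basis adapted to `Δ ⊕ (0 ⊕ 𝕍)` — conjugation by the unipotent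
`E₂ = (1 0; 1 1)`, `E₁ = E₂⁻¹ = (1 0; −1 1)` — a Siegel element is block upper-triangular with upper-left block
`h|_Δ = h₁₁ + h₁₂`, whence:
* `det h = det_Δ h · det(h₂₂ − h₁₂)`, so `det_Δ` is a unit on `P_Δ(𝔸)` (`isUnit_detDelta_of_isSiegelDelta`);
* `P_Δ(𝔸)` is closed under products and inverses and contains `1` (`isSiegelDelta_mul ∕ _inv ∕ _one'`);
* `det_Δ` is multiplicative on `P_Δ(𝔸)` (`detDelta_mul`), and so are the prescribed scalars `χ(det_Δ ·)`
  (`chiDet_mul`) and `|det_Δ ·|^{1/2}` (`modDelta_mul`); `det_Δ 1 = 1`, `χ(det_Δ 1) = 1`, `|det_Δ 1|^{1/2} = 1`;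
* the Weil operators compose (`opD_mul`), the Siegel relation entrywise (`isSiegelDelta_iff_entry`).
Theorems only (no definitions).
-/

set_option autoImplicit false

noncomputable section

open scoped Classical
open scoped Matrix Kronecker TensorProduct
open NumberField IsDedekindDomain
open Literature.RepresentationTheory.HeisenbergGroup
open Literature.NumberTheory.Automorphic
open Literature.NumberTheory.Weil1964
open Literature.RepresentationTheory.HarrisKudlaSweet1996
open Literature.NumberTheory.GaloisRepresentations

namespace Literature.NumberTheory.GelbartRogawski1991.GRConstruction

open UnitaryDualPair

variable (L : Type) [Field L] [NumberField L] [IsCMField L]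

variable {N M n : ℕ} (e : Fin N × Fin M ≃ Fin n)
  (dV : Fin N → L) (hdV : ∀ i, IsCMField.complexConj L (dV i) = dV i) (hdV0 : ∀ i, dV i ≠ 0)
  (dW : Fin M → L) (hdW : ∀ i, IsCMField.complexConj L (dW i) = dW i) (hdW0 : ∀ i, dW i ≠ 0)

/-! ## `det_Δ` is a unit on `P_Δ(𝔸)` -/

/-- block factorisation behind S3-unit: in the basis adapted to `Δ ⊕ (0 ⊕ 𝕍)` a Siegel `h` is block upper-triangular,
`E₁ · h · E₂ = (h|_Δ, h₁₂; 0, h₂₂ − h₁₂)` with unipotent `E₁ = (1 0; −1 1)`, `E₂ = (1 0; 1 1)`.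
[cite: Kudla1994, §2 (doubled space, Siegel parabolic), Thm. 3.1] -/
theorem blk_conj_eq_of_isSiegelDelta (h : HA L e dV hdV dW hdW) (hS : IsSiegelDelta L e dV hdV dW hdW h) :
    Matrix.fromBlocks (1 : Matrix (Fin n) (Fin n) (AdeleRing (𝓞 L) L)) 0 (-1) 1 * blk L e dV hdV dW hdW h *
        Matrix.fromBlocks 1 0 1 1 =
      Matrix.fromBlocks (deltaBlock L e dV hdV dW hdW h) (blk L e dV hdV dW hdW h).toBlocks₁₂ 0
        ((blk L e dV hdV dW hdW h).toBlocks₂₂ - (blk L e dV hdV dW hdW h).toBlocks₁₂) := by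
  set B := blk L e dV hdV dW hdW h with hB
  have hS' : B.toBlocks₁₁ + B.toBlocks₁₂ = B.toBlocks₂₁ + B.toBlocks₂₂ := hS
  have hB' : B = Matrix.fromBlocks B.toBlocks₁₁ B.toBlocks₁₂ B.toBlocks₂₁ B.toBlocks₂₂ :=
    (Matrix.fromBlocks_toBlocks B).symm
  conv_lhs => rw [hB']
  rw [Matrix.fromBlocks_multiply, Matrix.fromBlocks_multiply]
  simp only [Matrix.one_mul, Matrix.mul_one, Matrix.zero_mul, Matrix.mul_zero, add_zero, zero_add, Matrix.neg_mul,
    neg_add_eq_sub]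
  rw [Matrix.fromBlocks_inj]
  refine ⟨rfl, rfl, ?_, rfl⟩
  have h2 : B.toBlocks₂₁ - B.toBlocks₁₁ + (B.toBlocks₂₂ - B.toBlocks₁₂) =
      (B.toBlocks₂₁ + B.toBlocks₂₂) - (B.toBlocks₁₁ + B.toBlocks₁₂) := by abel
  rw [h2, ← hS', sub_self]

/-- for a Siegel `h`: `det h = det_Δ h · det (h₂₂ − h₁₂)` (block upper-triangular determinant).
[cite: Kudla1994, §2 (doubled space, Siegel parabolic), Thm. 3.1] -/
theorem det_blk_eq_of_isSiegelDelta (h : HA L e dV hdV dW hdW) (hS : IsSiegelDelta L e dV hdV dW hdW h) :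
    (blk L e dV hdV dW hdW h).det =
      detDelta L e dV hdV dW hdW h * ((blk L e dV hdV dW hdW h).toBlocks₂₂ - (blk L e dV hdV dW hdW h).toBlocks₁₂).det := by
  show _ = (deltaBlock L e dV hdV dW hdW h).det * _
  have h1 := congrArg Matrix.det (blk_conj_eq_of_isSiegelDelta L e dV hdV dW hdW h hS)
  rw [Matrix.det_mul, Matrix.det_mul, Matrix.det_fromBlocks_zero₁₂, Matrix.det_fromBlocks_zero₁₂,
    Matrix.det_fromBlocks_zero₂₁] at h1
  simpa only [Matrix.det_one, Matrix.det_neg, one_mul, mul_one] using h1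

/-- **S3-unit**: for `p ∈ P_Δ(𝔸)`, `det_Δ p` is a unit of `𝔸_L` (`det p = det_Δ p · det(p₂₂ − p₁₂)` and `det p` is a
unit). [cite: Kudla1994, §2 (doubled space, Siegel parabolic), Thm. 3.1] -/
theorem isUnit_detDelta_of_isSiegelDelta (p : HA L e dV hdV dW hdW) (hS : IsSiegelDelta L e dV hdV dW hdW p) :
    IsUnit (detDelta L e dV hdV dW hdW p) := by
  have h1 : IsUnit (blk L e dV hdV dW hdW p).det := by
    dsimp only [blk]
    rw [Matrix.det_reindex_self]
    exact (Matrix.isUnit_iff_isUnit_det _).mp (p : GL (Fin (n + n)) (AdeleRing (𝓞 L) L)).isUnit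
  rw [det_blk_eq_of_isSiegelDelta L e dV hdV dW hdW p hS] at h1
  exact isUnit_of_mul_isUnit_left h1


/-! ## Conjugation into the basis adapted to `Δ`; products -/

/-- `E₂ E₁ = 1` for the unipotent changes of basis `E₁ = (1 0; −1 1)`, `E₂ = (1 0; 1 1)` adapted to `Δ`.
[cite: Kudla1994, §2 (doubled space, Siegel parabolic), Thm. 3.1] -/
theorem E₂_mul_E₁ {R : Type*} [CommRing R] {m : Type*} [Fintype m] [DecidableEq m] :
    Matrix.fromBlocks (1 : Matrix m m R) 0 1 (1 : Matrix m m R) * Matrix.fromBlocks (1 : Matrix m m R) 0 (-1) (1 : Matrix m m R) =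
      (1 : Matrix (m ⊕ m) (m ⊕ m) R) := by
  rw [Matrix.fromBlocks_multiply]
  simp only [Matrix.mul_one, Matrix.mul_zero, add_zero, zero_add, Matrix.mul_neg,
    add_neg_cancel, neg_zero, ← Matrix.fromBlocks_one]

/-- the conjugate `E₁ M E₂` of a block matrix, blockwise.
[cite: Kudla1994, §2 (doubled space, Siegel parabolic), Thm. 3.1] -/
theorem conjE_eq {R : Type*} [CommRing R] {m : Type*} [Fintype m] [DecidableEq m] (A : Matrix (m ⊕ m) (m ⊕ m) R) :
    Matrix.fromBlocks (1 : Matrix m m R) 0 (-1) 1 * A * Matrix.fromBlocks 1 0 1 1 =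
      Matrix.fromBlocks (A.toBlocks₁₁ + A.toBlocks₁₂) A.toBlocks₁₂ (A.toBlocks₂₁ + A.toBlocks₂₂ - (A.toBlocks₁₁ + A.toBlocks₁₂))
        (A.toBlocks₂₂ - A.toBlocks₁₂) := by
  conv_lhs => rw [← Matrix.fromBlocks_toBlocks A]
  rw [Matrix.fromBlocks_multiply, Matrix.fromBlocks_multiply]
  simp only [Matrix.one_mul, Matrix.mul_one, Matrix.zero_mul, Matrix.mul_zero, add_zero, zero_add, Matrix.neg_mul]
  rw [Matrix.fromBlocks_inj]
  refine ⟨rfl, rfl, ?_, ?_⟩ <;> abel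

/-- block-triangular matrices multiply blockwise: zero lower-left blocks and the upper-left blocks multiply.
[cite: Kudla1994, §2 (doubled space, Siegel parabolic), Thm. 3.1] -/
theorem toBlocks_mul_of_toBlocks₂₁_eq_zero {R : Type*} [CommRing R] {m : Type*} [Fintype m] [DecidableEq m]
    (X Y : Matrix (m ⊕ m) (m ⊕ m) R) (hX : X.toBlocks₂₁ = 0) (hY : Y.toBlocks₂₁ = 0) :
    (X * Y).toBlocks₂₁ = 0 ∧ (X * Y).toBlocks₁₁ = X.toBlocks₁₁ * Y.toBlocks₁₁ := by
  have hX' : X = Matrix.fromBlocks X.toBlocks₁₁ X.toBlocks₁₂ 0 X.toBlocks₂₂ := by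
    rw [← hX]; exact (Matrix.fromBlocks_toBlocks X).symm
  have hY' : Y = Matrix.fromBlocks Y.toBlocks₁₁ Y.toBlocks₁₂ 0 Y.toBlocks₂₂ := by
    rw [← hY]; exact (Matrix.fromBlocks_toBlocks Y).symm
  rw [hX', hY', Matrix.fromBlocks_multiply]
  simp only [Matrix.toBlocks_fromBlocks₂₁, Matrix.toBlocks_fromBlocks₁₁, Matrix.zero_mul, Matrix.mul_zero, add_zero,
    and_self]

/-- `blk` is multiplicative. [cite: Kudla1994, §2 (doubled space, Siegel parabolic), Thm. 3.1] -/
theorem blk_mul (p q : HA L e dV hdV dW hdW) : blk L e dV hdV dW hdW (p * q) = blk L e dV hdV dW hdW p * blk L e dV hdV dW hdW q := by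
  simp only [blk, Matrix.reindex_apply, Equiv.symm_symm, Subgroup.coe_mul, Units.val_mul]
  exact (Matrix.submatrix_mul_equiv _ _ _ _ _).symm

/-- the Siegel condition as vanishing of the lower-left block of `E₁ (blk h) E₂`.
[cite: Kudla1994, §2 (doubled space, Siegel parabolic), Thm. 3.1] -/
theorem isSiegelDelta_iff_conj (h : HA L e dV hdV dW hdW) :
    IsSiegelDelta L e dV hdV dW hdW h ↔
      (Matrix.fromBlocks (1 : Matrix (Fin n) (Fin n) (AdeleRing (𝓞 L) L)) 0 (-1) 1 * blk L e dV hdV dW hdW h *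
        Matrix.fromBlocks 1 0 1 1).toBlocks₂₁ = 0 := by
  rw [conjE_eq, Matrix.toBlocks_fromBlocks₂₁, sub_eq_zero, eq_comm]
  exact Iff.rfl

/-- `h|_Δ` as the upper-left block of `E₁ (blk h) E₂`.
[cite: Kudla1994, §2 (doubled space, Siegel parabolic), Thm. 3.1] -/
theorem deltaBlock_eq_conj (h : HA L e dV hdV dW hdW) :
    deltaBlock L e dV hdV dW hdW h =
      (Matrix.fromBlocks (1 : Matrix (Fin n) (Fin n) (AdeleRing (𝓞 L) L)) 0 (-1) 1 * blk L e dV hdV dW hdW h *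
        Matrix.fromBlocks 1 0 1 1).toBlocks₁₁ := by
  rw [conjE_eq, Matrix.toBlocks_fromBlocks₁₁]
  rfl

/-- `E₁ blk(pq) E₂ = (E₁ blk p E₂)(E₁ blk q E₂)`. [cite: Kudla1994, §2 (doubled space, Siegel parabolic), Thm. 3.1] -/
theorem conj_blk_mul (p q : HA L e dV hdV dW hdW) :
    Matrix.fromBlocks (1 : Matrix (Fin n) (Fin n) (AdeleRing (𝓞 L) L)) 0 (-1) 1 * blk L e dV hdV dW hdW (p * q) *
        Matrix.fromBlocks 1 0 1 1 =
      Matrix.fromBlocks (1 : Matrix (Fin n) (Fin n) (AdeleRing (𝓞 L) L)) 0 (-1) 1 * blk L e dV hdV dW hdW p *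
          Matrix.fromBlocks 1 0 1 1 *
        (Matrix.fromBlocks (1 : Matrix (Fin n) (Fin n) (AdeleRing (𝓞 L) L)) 0 (-1) 1 * blk L e dV hdV dW hdW q *
          Matrix.fromBlocks 1 0 1 1) := by
  have h : Matrix.fromBlocks (1 : Matrix (Fin n) (Fin n) (AdeleRing (𝓞 L) L)) 0 (-1) 1 * blk L e dV hdV dW hdW p *
          Matrix.fromBlocks 1 0 1 1 *
        (Matrix.fromBlocks (1 : Matrix (Fin n) (Fin n) (AdeleRing (𝓞 L) L)) 0 (-1) 1 * blk L e dV hdV dW hdW q *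
          Matrix.fromBlocks 1 0 1 1) =
      Matrix.fromBlocks (1 : Matrix (Fin n) (Fin n) (AdeleRing (𝓞 L) L)) 0 (-1) 1 *
        (blk L e dV hdV dW hdW p * (Matrix.fromBlocks (1 : Matrix (Fin n) (Fin n) (AdeleRing (𝓞 L) L)) 0 1 1 *
          Matrix.fromBlocks 1 0 (-1) 1) * blk L e dV hdV dW hdW q) * Matrix.fromBlocks 1 0 1 1 := by
    simp only [Matrix.mul_assoc]
  rw [h, E₂_mul_E₁, Matrix.mul_one, blk_mul]

/-- `P_Δ(𝔸)` is closed under products. [cite: Kudla1994, §2 (doubled space, Siegel parabolic), Thm. 3.1] -/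
theorem isSiegelDelta_mul {p q : HA L e dV hdV dW hdW} (hp : IsSiegelDelta L e dV hdV dW hdW p)
    (hq : IsSiegelDelta L e dV hdV dW hdW q) : IsSiegelDelta L e dV hdV dW hdW (p * q) :=
  (isSiegelDelta_iff_conj L e dV hdV dW hdW (p * q)).2 (by
    rw [conj_blk_mul]
    exact (toBlocks_mul_of_toBlocks₂₁_eq_zero _ _ ((isSiegelDelta_iff_conj L e dV hdV dW hdW p).1 hp)
      ((isSiegelDelta_iff_conj L e dV hdV dW hdW q).1 hq)).1)

/-- `(pq)|_Δ = p|_Δ q|_Δ` on `P_Δ(𝔸)`. [cite: Kudla1994, §2 (doubled space, Siegel parabolic), Thm. 3.1] -/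
theorem deltaBlock_mul {p q : HA L e dV hdV dW hdW} (hp : IsSiegelDelta L e dV hdV dW hdW p)
    (hq : IsSiegelDelta L e dV hdV dW hdW q) :
    deltaBlock L e dV hdV dW hdW (p * q) = deltaBlock L e dV hdV dW hdW p * deltaBlock L e dV hdV dW hdW q := by
  rw [deltaBlock_eq_conj, deltaBlock_eq_conj, deltaBlock_eq_conj, conj_blk_mul]
  exact (toBlocks_mul_of_toBlocks₂₁_eq_zero _ _ ((isSiegelDelta_iff_conj L e dV hdV dW hdW p).1 hp)
    ((isSiegelDelta_iff_conj L e dV hdV dW hdW q).1 hq)).2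

/-- `det_Δ` is multiplicative on `P_Δ(𝔸)`. [cite: Kudla1994, §2 (doubled space, Siegel parabolic), Thm. 3.1] -/
theorem detDelta_mul {p q : HA L e dV hdV dW hdW} (hp : IsSiegelDelta L e dV hdV dW hdW p)
    (hq : IsSiegelDelta L e dV hdV dW hdW q) :
    detDelta L e dV hdV dW hdW (p * q) = detDelta L e dV hdV dW hdW p * detDelta L e dV hdV dW hdW q := by
  unfold detDelta
  rw [deltaBlock_mul L e dV hdV dW hdW hp hq, Matrix.det_mul]

/-- `χ(det_Δ ·)` is multiplicative on `P_Δ(𝔸)`. [cite: Kudla1994, §2 (doubled space, Siegel parabolic), Thm. 3.1] -/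
theorem chiDet_mul (χ : HeckeCharacter L) {p q : HA L e dV hdV dW hdW} (hp : IsSiegelDelta L e dV hdV dW hdW p)
    (hq : IsSiegelDelta L e dV hdV dW hdW q) :
    chiDet L e dV hdV dW hdW χ (p * q) = chiDet L e dV hdV dW hdW χ p * chiDet L e dV hdV dW hdW χ q := by
  have hup := isUnit_detDelta_of_isSiegelDelta L e dV hdV dW hdW p hp
  have huq := isUnit_detDelta_of_isSiegelDelta L e dV hdV dW hdW q hq
  have hu := isUnit_detDelta_of_isSiegelDelta L e dV hdV dW hdW (p * q) (isSiegelDelta_mul L e dV hdV dW hdW hp hq)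
  have hunit : hu.unit = hup.unit * huq.unit :=
    Units.ext (by rw [Units.val_mul, IsUnit.unit_spec, IsUnit.unit_spec, IsUnit.unit_spec, detDelta_mul L e dV hdV dW hdW hp hq])
  unfold chiDet
  rw [dif_pos hu, dif_pos hup, dif_pos huq, ← map_mul, hunit]

/-- `|det_Δ ·|^{1/2}` is multiplicative on `P_Δ(𝔸)`.
[cite: Kudla1994, §2 (doubled space, Siegel parabolic), Thm. 3.1] -/
theorem modDelta_mul {p q : HA L e dV hdV dW hdW} (hp : IsSiegelDelta L e dV hdV dW hdW p)
    (hq : IsSiegelDelta L e dV hdV dW hdW q) :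
    modDelta L e dV hdV dW hdW (p * q) = modDelta L e dV hdV dW hdW p * modDelta L e dV hdV dW hdW q := by
  have hup := isUnit_detDelta_of_isSiegelDelta L e dV hdV dW hdW p hp
  have huq := isUnit_detDelta_of_isSiegelDelta L e dV hdV dW hdW q hq
  have hu := isUnit_detDelta_of_isSiegelDelta L e dV hdV dW hdW (p * q) (isSiegelDelta_mul L e dV hdV dW hdW hp hq)
  have hunit : hu.unit = hup.unit * huq.unit :=
    Units.ext (by rw [Units.val_mul, IsUnit.unit_spec, IsUnit.unit_spec, IsUnit.unit_spec, detDelta_mul L e dV hdV dW hdW hp hq])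
  unfold modDelta
  rw [dif_pos hu, dif_pos hup, dif_pos huq, hunit, ← coe_ideleNorm, ← coe_ideleNorm, ← coe_ideleNorm, map_mul, NNReal.coe_mul,
    Real.sqrt_mul (NNReal.coe_nonneg _)]

set_option maxHeartbeats 800000 in
/-- `ω(XY)Φ = ω(X)(ω(Y)Φ)` as functions. [cite: Kudla1994, §2 (doubled space, Siegel parabolic), Thm. 3.1] -/
theorem opD_mul (X Y : MpD L e dV hdV dW hdW) (Φ : piSchwartzBruhat (Fp L) (Fin (n + n))) :
    opD L e dV hdV dW hdW (X * Y) Φ =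
      opD L e dV hdV dW hdW X (adelicMpCont.omega (Fp L) (Fin (n + n)) (gramDA L e dV hdV dW hdW) Y Φ) := by
  exact congrArg (fun T : piSchwartzBruhat (Fp L) (Fin (n + n)) →ₗ[ℂ] piSchwartzBruhat (Fp L) (Fin (n + n)) =>
      ((T Φ : piSchwartzBruhat (Fp L) (Fin (n + n))) : (Fin (n + n) → AdeleRing (𝓞 (Fp L)) (Fp L)) → ℂ))
    ((adelicMpCont.omega (Fp L) (Fin (n + n)) (gramDA L e dV hdV dW hdW)).map_mul X Y)

/-- the Siegel condition entrywise. [cite: Kudla1994, §2 (doubled space, Siegel parabolic), Thm. 3.1] -/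
theorem isSiegelDelta_iff_entry (X : HA L e dV hdV dW hdW) :
    IsSiegelDelta L e dV hdV dW hdW X ↔ ∀ i j : Fin n,
      ((X : GL (Fin (n + n)) (AdeleRing (𝓞 L) L)) : Matrix _ _ (AdeleRing (𝓞 L) L)) (e₂ (Sum.inl i)) (e₂ (Sum.inl j)) +
          ((X : GL (Fin (n + n)) (AdeleRing (𝓞 L) L)) : Matrix _ _ (AdeleRing (𝓞 L) L)) (e₂ (Sum.inl i)) (e₂ (Sum.inr j)) =
        ((X : GL (Fin (n + n)) (AdeleRing (𝓞 L) L)) : Matrix _ _ (AdeleRing (𝓞 L) L)) (e₂ (Sum.inr i)) (e₂ (Sum.inl j)) +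
          ((X : GL (Fin (n + n)) (AdeleRing (𝓞 L) L)) : Matrix _ _ (AdeleRing (𝓞 L) L)) (e₂ (Sum.inr i)) (e₂ (Sum.inr j)) := by
  unfold IsSiegelDelta
  rw [← Matrix.ext_iff]
  simp only [blk, Matrix.add_apply, Matrix.toBlocks₁₁, Matrix.toBlocks₁₂, Matrix.toBlocks₂₁, Matrix.toBlocks₂₂,
    Matrix.of_apply, Matrix.reindex_apply, Matrix.submatrix_apply, Equiv.symm_symm]

/-- the Kronecker block identity behind S1par-comp: `δ` restricted to the `Δ`-pattern.
[cite: Kudla1994, §2 (doubled space, Siegel parabolic), Thm. 3.1] -/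
theorem one_apply_siegel {R : Type*} [Semiring R] (i j : Fin n) :
    (1 : Matrix (Fin (n + n)) (Fin (n + n)) R) (e₂ (Sum.inl i)) (e₂ (Sum.inl j)) +
        (1 : Matrix (Fin (n + n)) (Fin (n + n)) R) (e₂ (Sum.inl i)) (e₂ (Sum.inr j)) =
      (1 : Matrix (Fin (n + n)) (Fin (n + n)) R) (e₂ (Sum.inr i)) (e₂ (Sum.inl j)) +
        (1 : Matrix (Fin (n + n)) (Fin (n + n)) R) (e₂ (Sum.inr i)) (e₂ (Sum.inr j)) := by
  simp [Matrix.one_apply, (e₂ (n := n)).injective.eq_iff, -finSumFinEquiv_apply_left, -finSumFinEquiv_apply_right]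

/-! ## Inverses and the identity -/

/-- `E₁ E₂ = 1`. [cite: Kudla1994, §2 (doubled space, Siegel parabolic), Thm. 3.1] -/
theorem E₁_mul_E₂ {R : Type*} [CommRing R] {m : Type*} [Fintype m] [DecidableEq m] :
    Matrix.fromBlocks (1 : Matrix m m R) 0 (-1) (1 : Matrix m m R) * Matrix.fromBlocks (1 : Matrix m m R) 0 1 (1 : Matrix m m R) =
      (1 : Matrix (m ⊕ m) (m ⊕ m) R) := by
  rw [Matrix.fromBlocks_multiply]
  simp only [Matrix.mul_one, Matrix.mul_zero, add_zero, zero_add, neg_add_cancel, ← Matrix.fromBlocks_one]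

/-- `E₁ blk(1) E₂ = 1`. [cite: Kudla1994, §2 (doubled space, Siegel parabolic), Thm. 3.1] -/
theorem conj_blk_one :
    Matrix.fromBlocks (1 : Matrix (Fin n) (Fin n) (AdeleRing (𝓞 L) L)) 0 (-1) 1 * blk L e dV hdV dW hdW 1 *
        Matrix.fromBlocks 1 0 1 1 = 1 := by
  have h1 : blk L e dV hdV dW hdW 1 = 1 := by
    simp only [blk, Matrix.reindex_apply, Subgroup.coe_one, Units.val_one, Matrix.submatrix_one_equiv]
  rw [h1, Matrix.mul_one, E₁_mul_E₂]

/-- **`P_Δ(𝔸)` is closed under inverses.** [cite: Kudla1994, §2 (doubled space, Siegel parabolic), Thm. 3.1] -/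
theorem isSiegelDelta_inv {p : HA L e dV hdV dW hdW} (hp : IsSiegelDelta L e dV hdV dW hdW p) :
    IsSiegelDelta L e dV hdV dW hdW p⁻¹ := by
  set X := Matrix.fromBlocks (1 : Matrix (Fin n) (Fin n) (AdeleRing (𝓞 L) L)) 0 (-1) 1 * blk L e dV hdV dW hdW p *
    Matrix.fromBlocks 1 0 1 1 with hX
  set Y := Matrix.fromBlocks (1 : Matrix (Fin n) (Fin n) (AdeleRing (𝓞 L) L)) 0 (-1) 1 * blk L e dV hdV dW hdW p⁻¹ *
    Matrix.fromBlocks 1 0 1 1 with hY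
  have hXY : X * Y = 1 := by rw [hX, hY, ← conj_blk_mul, mul_inv_cancel, conj_blk_one]
  have hX21 : X.toBlocks₂₁ = 0 := (isSiegelDelta_iff_conj L e dV hdV dW hdW p).1 hp
  -- `det X` is a unit, hence so is `det X₂₂`
  have hXu : IsUnit X.det := by
    have h : IsUnit (X * Y).det := by rw [hXY, Matrix.det_one]; exact isUnit_one
    rw [Matrix.det_mul] at h
    exact isUnit_of_mul_isUnit_left h
  have hXblocks : X = Matrix.fromBlocks X.toBlocks₁₁ X.toBlocks₁₂ 0 X.toBlocks₂₂ := by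
    conv_lhs => rw [← Matrix.fromBlocks_toBlocks X, hX21]
  have hD : IsUnit X.toBlocks₂₂.det := by
    rw [hXblocks, Matrix.det_fromBlocks_zero₂₁] at hXu
    exact isUnit_of_mul_isUnit_right hXu
  -- `(XY)₂₁ = X₂₂ Y₂₁ = 0`
  have h21 : X.toBlocks₂₂ * Y.toBlocks₂₁ = 0 := by
    have h := congrArg Matrix.toBlocks₂₁ hXY
    rw [hXblocks, ← Matrix.fromBlocks_toBlocks Y, Matrix.fromBlocks_multiply, Matrix.toBlocks_fromBlocks₂₁,
      Matrix.zero_mul, zero_add] at h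
    rw [h, ← Matrix.fromBlocks_one, Matrix.toBlocks_fromBlocks₂₁]
  refine (isSiegelDelta_iff_conj L e dV hdV dW hdW p⁻¹).2 ?_
  calc Y.toBlocks₂₁ = X.toBlocks₂₂⁻¹ * (X.toBlocks₂₂ * Y.toBlocks₂₁) := by
        rw [← Matrix.mul_assoc, Matrix.nonsing_inv_mul _ hD, Matrix.one_mul]
    _ = 0 := by rw [h21, Matrix.mul_zero]


/-- `blk 1 = 1`. [cite: Kudla1994, §2 (doubled space, Siegel parabolic), Thm. 3.1] -/
theorem blk_one : blk L e dV hdV dW hdW 1 = 1 := by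
  simp only [blk, Matrix.reindex_apply, Subgroup.coe_one, Units.val_one, Matrix.submatrix_one_equiv]

/-- `1 ∈ P_Δ(𝔸)`. [cite: Kudla1994, §2 (doubled space, Siegel parabolic), Thm. 3.1] -/
theorem isSiegelDelta_one' : IsSiegelDelta L e dV hdV dW hdW 1 := by
  unfold IsSiegelDelta
  rw [blk_one, ← Matrix.fromBlocks_one, Matrix.toBlocks_fromBlocks₁₁, Matrix.toBlocks_fromBlocks₁₂,
    Matrix.toBlocks_fromBlocks₂₁, Matrix.toBlocks_fromBlocks₂₂, add_zero, zero_add]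

/-- `det_Δ 1 = 1`. [cite: Kudla1994, §2 (doubled space, Siegel parabolic), Thm. 3.1] -/
theorem detDelta_one' : detDelta L e dV hdV dW hdW 1 = 1 := by
  unfold detDelta deltaBlock
  rw [blk_one, ← Matrix.fromBlocks_one, Matrix.toBlocks_fromBlocks₁₁, Matrix.toBlocks_fromBlocks₁₂, add_zero,
    Matrix.det_one]

/-- `det_Δ p⁻¹ · det_Δ p = 1` on `P_Δ(𝔸)`. [cite: Kudla1994, §2 (doubled space, Siegel parabolic), Thm. 3.1] -/
theorem detDelta_inv_mul {p : HA L e dV hdV dW hdW} (hp : IsSiegelDelta L e dV hdV dW hdW p) :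
    detDelta L e dV hdV dW hdW p⁻¹ * detDelta L e dV hdV dW hdW p = 1 := by
  rw [← detDelta_mul L e dV hdV dW hdW (isSiegelDelta_inv L e dV hdV dW hdW hp) hp, inv_mul_cancel, detDelta_one']

/-- `det_Δ p · det_Δ p⁻¹ = 1` on `P_Δ(𝔸)`. [cite: Kudla1994, §2 (doubled space, Siegel parabolic), Thm. 3.1] -/
theorem detDelta_mul_inv {p : HA L e dV hdV dW hdW} (hp : IsSiegelDelta L e dV hdV dW hdW p) :
    detDelta L e dV hdV dW hdW p * detDelta L e dV hdV dW hdW p⁻¹ = 1 := by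
  rw [← detDelta_mul L e dV hdV dW hdW hp (isSiegelDelta_inv L e dV hdV dW hdW hp), mul_inv_cancel, detDelta_one']

/-! ## The prescribed scalars at `1` -/

/-- `χ(det_Δ 1) = 1`. [cite: Kudla1994, §2 (doubled space, Siegel parabolic), Thm. 3.1] -/
theorem chiDet_one' (χ : HeckeCharacter L) : chiDet L e dV hdV dW hdW χ 1 = 1 := by
  have hu : IsUnit (detDelta L e dV hdV dW hdW 1) := by rw [detDelta_one']; exact isUnit_one
  have h1 : hu.unit = 1 := Units.ext (by rw [IsUnit.unit_spec, detDelta_one', Units.val_one])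
  unfold chiDet
  rw [dif_pos hu, h1, map_one]

/-- `|det_Δ 1|^{1/2} = 1`. [cite: Kudla1994, §2 (doubled space, Siegel parabolic), Thm. 3.1] -/
theorem modDelta_one' : modDelta L e dV hdV dW hdW 1 = 1 := by
  have hu : IsUnit (detDelta L e dV hdV dW hdW 1) := by rw [detDelta_one']; exact isUnit_one
  have h1 : hu.unit = 1 := Units.ext (by rw [IsUnit.unit_spec, detDelta_one', Units.val_one])
  unfold modDelta
  rw [dif_pos hu, h1, ← coe_ideleNorm, map_one, NNReal.coe_one, Real.sqrt_one]


end Literature.NumberTheory.GelbartRogawski1991.GRConstruction
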